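import Summits.BirchSwinnertonDyer.BirchSwinnertonDyer.Theorems.Rank2Observatory2DescClEtaCert
import HarnessLib

/-!
# BirchSwinnertonDyer — rank ≥ 2 observatory: KERNEL-2DESC-CL ΩD — elements over the basis `(1, α, ω)`, part 1

HONEST FRAMING: per-curve certified theorems and census instruments; no claim on BSD in rank ≥ 2.

Design `generics/e2d/E2D-DESIGN.md` §4 (cert-1 gen 30/31).  The two-view element of v2.3/E2Q2
(`…2DescClEtaCert`: `x` carried as `X = m₁x ∈ ℤ[α]` and `Y = m₂x ∈ ℤ[η]` with `gcd(m₁, m₂) = 1`) cannot present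
the integers of a cubic field with COMMON INDEX DIVISOR `2` (the `73` complex cubic 2-division fields of the
rank-2 census in which `2` is totally split): there EVERY `θ ∈ 𝓞 K` has even index, so no Bezout pair exists.
This file presents an `x ∈ 𝓞 K` instead by its coordinates over `(1, α, ω)`, `ω = u(α)/d ∈ 𝓞 K` a second
algebraic integer certified by `etaCheck` (a root of a monic integer cubic `h`, so `MonicCubic.thetaInt` applies):
* `omegaElt hθ hω W = W₀ + W₁·α + W₂·ω ∈ 𝓞 K` — integral BY CONSTRUCTION (no claim that `(1, α, ω)` is an integral
  basis is made or needed);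
* `omegaCheck u d M X W` — the decidable identity `d·X = M·(d·(W₀, W₁, 0) + W₂·u)` of `α`-coordinate triples, i.e.
  `M·x = X(α)` cleared of the denominator `d`; `natCast_mul_omegaElt`: `(M : 𝓞 K) · x = X(α)` (`lin hθ X`);
* `omega_dispatch`: at a prime `w ∋ p` with `p ∤ M`, membership and valuation of `x` are those of `X(α)`
  (`natCast_not_mem_of_coprime`, `mem_iff_of_natCast_mul_eq`, `valuation_eq_of_natCast_mul_eq` of `…2DescClEtaCert`);
  at the primes above `2` (where `2 ∣ M` typically) membership is read instead through the `2`-adic ROOT VIEW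
  (`…2DescPadicRootTriple`: `RootedPrime.mem / not_mem` take exactly the hypothesis `(M : 𝓞 K) · x = lin hθ X`);
* `avatarD u d W = d·(W₀, W₁, 0) + W₂·u` — the `α`-avatar of `d·x`, `natCast_mul_omegaElt_avatarD`.
Kernel sanity at the end: the field `Δ_K = −26743` (`g = X³ − X² − 20X − 124`, `ω = (−14 − 3α + α²)/4`,
`h = X³ + X² + 42X − 144`) passes `etaCheck`, and its dyadic separator `s = −ω` (`X = 4s = (14, 3, −1)`) passes
`omegaCheck` with `M = d = 4`, by `decide +kernel`.
Sorry-free; new declarations only; axioms `propext`, `Classical.choice`, `Quot.sound`.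
[cite: Cohen1993, §4.8.2, §6.1 (integral bases of cubic fields; the index and common index divisors)]
[cite: Marcus2018, Ch. 3, Thm. 27]
-/

set_option linter.dupNamespace false

noncomputable section

open scoped Classical NumberField nonZeroDivisors

open Literature.NumberTheory.NumberFields Polynomial Module NumberField IsDedekindDomain Ideal

namespace Summit.BirchSwinnertonDyer.BirchSwinnertonDyer.Rank2Observatory.TwoDescCl

open TwoDescCubic

variable {K : Type*} [Field K] [NumberField K] {a b c : ℤ} {θ : K}

/-! ## `ω`-elements -/

/-- **The element `W₀ + W₁·α + W₂·ω ∈ 𝓞 K`**, `ω = u(α)/d` a certified algebraic integer (a root of the monic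
cubic `X³ + a′X² + b′X + c′`). Integral by construction. [folklore] -/
def omegaElt (hθ : aeval θ (MonicCubic.poly a b c) = 0) {u : ℤ × ℤ × ℤ} {d : ℕ} {a' b' c' : ℤ}
    (hω : aeval (eta θ u d) (MonicCubic.poly a' b' c') = 0) (W : ℤ × ℤ × ℤ) : 𝓞 K :=
  lin hθ W.1 W.2.1 0 + lin hω 0 W.2.2 0

omit [NumberField K] in
/-- `omegaElt` in `K`. [folklore] -/
theorem algebraMap_omegaElt (hθ : aeval θ (MonicCubic.poly a b c) = 0) {u : ℤ × ℤ × ℤ} {d : ℕ} {a' b' c' : ℤ}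
    (hω : aeval (eta θ u d) (MonicCubic.poly a' b' c') = 0) (W : ℤ × ℤ × ℤ) :
    algebraMap (𝓞 K) K (omegaElt hθ hω W) = (W.1 : K) + (W.2.1 : K) * θ + (W.2.2 : K) * eta θ u d := by
  simp only [omegaElt, map_add, algebraMap_lin, Int.cast_zero, zero_mul, add_zero, zero_add]

/-- **Consistency certificate of an `ω`-element with its `α`-avatar**: `d·X = M·(d·(W₀, W₁, 0) + W₂·u)` as
`α`-coordinate triples (i.e. `M·x = X(α)` multiplied by `d`). Computable. [folklore] -/
def omegaCheck (u : ℤ × ℤ × ℤ) (d M : ℕ) (X W : ℤ × ℤ × ℤ) : Bool :=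
  decide (smulCoords (d : ℤ) X = smulCoords (M : ℤ) (smulCoords (d : ℤ) (W.1, W.2.1, 0) + smulCoords W.2.2 u))

/-- **`M · x = X(α)` in `K`** from the consistency certificate. [folklore] -/
theorem coe_omegaElt_of_omegaCheck (hθ : aeval θ (MonicCubic.poly a b c) = 0) {u : ℤ × ℤ × ℤ} {d : ℕ}
    (hd : 0 < d) {a' b' c' : ℤ} (hω : aeval (eta θ u d) (MonicCubic.poly a' b' c') = 0) {M : ℕ}
    {X W : ℤ × ℤ × ℤ} (h : omegaCheck u d M X W = true) :
    (M : K) * algebraMap (𝓞 K) K (omegaElt hθ hω W) = algebraMap (𝓞 K) K (lin hθ X.1 X.2.1 X.2.2) := by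
  simp only [omegaCheck, decide_eq_true_eq] at h
  have e := congrArg (MonicCubic.evalCoords θ) h
  simp only [MonicCubic.evalCoords_add, evalCoords_smulCoords] at e
  have hu : MonicCubic.evalCoords θ u = (d : K) * eta θ u d := by
    rw [natCast_mul_eta θ u hd]; simp only [MonicCubic.evalCoords]
  have hX : algebraMap (𝓞 K) K (lin hθ X.1 X.2.1 X.2.2) = MonicCubic.evalCoords θ X := by
    rw [algebraMap_lin]; simp only [MonicCubic.evalCoords]
  have hW : MonicCubic.evalCoords θ ((W.1, W.2.1, 0) : ℤ × ℤ × ℤ) = (W.1 : K) + (W.2.1 : K) * θ := by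
    simp only [MonicCubic.evalCoords, Int.cast_zero, zero_mul, add_zero]
  rw [hu, hW] at e
  rw [hX, algebraMap_omegaElt]
  have hd' : (d : K) ≠ 0 := Nat.cast_ne_zero.mpr hd.ne'
  apply (mul_right_injective₀ hd')
  simp only
  push_cast at e
  linear_combination -e

/-- **`(M : 𝓞 K) · x = X(α)` in `𝓞 K`** from the consistency certificate. [folklore] -/
theorem natCast_mul_omegaElt (hθ : aeval θ (MonicCubic.poly a b c) = 0) {u : ℤ × ℤ × ℤ} {d : ℕ}
    (hd : 0 < d) {a' b' c' : ℤ} (hω : aeval (eta θ u d) (MonicCubic.poly a' b' c') = 0) {M : ℕ}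
    {X W : ℤ × ℤ × ℤ} (h : omegaCheck u d M X W = true) :
    (M : 𝓞 K) * omegaElt hθ hω W = lin hθ X.1 X.2.1 X.2.2 := by
  apply IsFractionRing.injective (𝓞 K) K
  rw [map_mul, map_natCast]
  exact coe_omegaElt_of_omegaCheck hθ hd hω h

/-- The same with the multiplier cast through `ℤ` (the form `RootedPrime.mem / not_mem` consume). [folklore] -/
theorem intCast_mul_omegaElt (hθ : aeval θ (MonicCubic.poly a b c) = 0) {u : ℤ × ℤ × ℤ} {d : ℕ}
    (hd : 0 < d) {a' b' c' : ℤ} (hω : aeval (eta θ u d) (MonicCubic.poly a' b' c') = 0) {M : ℕ}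
    {X W : ℤ × ℤ × ℤ} (h : omegaCheck u d M X W = true) :
    (((M : ℕ) : ℤ) : 𝓞 K) * omegaElt hθ hω W = lin hθ X.1 X.2.1 X.2.2 := by
  rw [Int.cast_natCast]; exact natCast_mul_omegaElt hθ hd hω h

/-- **`α`-view dispatch for an `ω`-element**: at a prime `w ∋ p` with `p ∤ M`, `x ∈ w ↔ X(α) ∈ w` and
`v_w(x) = v_w(X(α))`. [folklore] -/
theorem omega_dispatch (hθ : aeval θ (MonicCubic.poly a b c) = 0) {u : ℤ × ℤ × ℤ} {d : ℕ}
    (hd : 0 < d) {a' b' c' : ℤ} (hω : aeval (eta θ u d) (MonicCubic.poly a' b' c') = 0) {M : ℕ}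
    {X W : ℤ × ℤ × ℤ} (h : omegaCheck u d M X W = true)
    (w : HeightOneSpectrum (𝓞 K)) {p : ℕ} (hp : (p : 𝓞 K) ∈ w.asIdeal) (hpd : Nat.Coprime M p) :
    (omegaElt hθ hω W ∈ w.asIdeal ↔ lin hθ X.1 X.2.1 X.2.2 ∈ w.asIdeal) ∧
      w.valuation K ((omegaElt hθ hω W : 𝓞 K) : K) = w.valuation K ((lin hθ X.1 X.2.1 X.2.2 : 𝓞 K) : K) := by
  have hm := natCast_not_mem_of_coprime w hp hpd
  have e := natCast_mul_omegaElt hθ hd hω h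
  exact ⟨mem_iff_of_natCast_mul_eq w hm e, valuation_eq_of_natCast_mul_eq w hm e⟩

/-! ## The `α`-avatar of `d · x` -/

/-- **The `α`-avatar of `d·x`** for `x = W₀ + W₁α + W₂ω`: `d·(W₀, W₁, 0) + W₂·u`. Computable. [folklore] -/
def avatarD (u : ℤ × ℤ × ℤ) (d : ℕ) (W : ℤ × ℤ × ℤ) : ℤ × ℤ × ℤ :=
  smulCoords (d : ℤ) (W.1, W.2.1, 0) + smulCoords W.2.2 u

/-- The avatar passes `omegaCheck` with `M = d`. [folklore] -/
theorem omegaCheck_avatarD (u : ℤ × ℤ × ℤ) (d : ℕ) (W : ℤ × ℤ × ℤ) :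
    omegaCheck u d d (avatarD u d W) W = true := by
  simp only [omegaCheck, avatarD, decide_eq_true_eq]

/-- **`(d : 𝓞 K) · x = (avatarD u d W)(α)`.** [folklore] -/
theorem natCast_mul_omegaElt_avatarD (hθ : aeval θ (MonicCubic.poly a b c) = 0) {u : ℤ × ℤ × ℤ} {d : ℕ}
    (hd : 0 < d) {a' b' c' : ℤ} (hω : aeval (eta θ u d) (MonicCubic.poly a' b' c') = 0) (W : ℤ × ℤ × ℤ) :
    (d : 𝓞 K) * omegaElt hθ hω W = lin hθ (avatarD u d W).1 (avatarD u d W).2.1 (avatarD u d W).2.2 :=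
  natCast_mul_omegaElt hθ hd hω (omegaCheck_avatarD u d W)

/-- The same with `d` cast through `ℤ`. [folklore] -/
theorem intCast_mul_omegaElt_avatarD (hθ : aeval θ (MonicCubic.poly a b c) = 0) {u : ℤ × ℤ × ℤ} {d : ℕ}
    (hd : 0 < d) {a' b' c' : ℤ} (hω : aeval (eta θ u d) (MonicCubic.poly a' b' c') = 0) (W : ℤ × ℤ × ℤ) :
    (((d : ℕ) : ℤ) : 𝓞 K) * omegaElt hθ hω W =
      lin hθ (avatarD u d W).1 (avatarD u d W).2.1 (avatarD u d W).2.2 := by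
  rw [Int.cast_natCast]; exact natCast_mul_omegaElt_avatarD hθ hd hω W

/-! ## Norm and non-vanishing through the avatar -/

/-- `|N(M)|·… : |N((M : 𝓞 K))| = M³` in a cubic field. [folklore] -/
theorem norm_natCast_cubic (h3 : finrank ℚ K = 3) (M : ℕ) : Algebra.norm ℤ (M : 𝓞 K) = (M : ℤ) ^ 3 := by
  rw [show (M : 𝓞 K) = algebraMap ℤ (𝓞 K) (M : ℤ) by simp, Algebra.norm_algebraMap,
    NumberField.RingOfIntegers.rank, h3]

/-- **`|N(x)| · M³ = |N(X)|`** for an `ω`-element with avatar `X = M·x`. [folklore] -/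
theorem natAbs_norm_omegaElt_mul (hirr : Irreducible (MonicCubic.polyQ a b c))
    (hθ : aeval θ (MonicCubic.poly a b c) = 0) (h3 : finrank ℚ K = 3) {u : ℤ × ℤ × ℤ} {d : ℕ} (hd : 0 < d)
    {a' b' c' : ℤ} (hω : aeval (eta θ u d) (MonicCubic.poly a' b' c') = 0) {M : ℕ} {X W : ℤ × ℤ × ℤ}
    (h : omegaCheck u d M X W = true) :
    M ^ 3 * (Algebra.norm ℤ (omegaElt hθ hω W)).natAbs = (normFormZ a b c X.1 X.2.1 X.2.2).natAbs := by
  have e := congrArg (fun y : 𝓞 K => (Algebra.norm ℤ y).natAbs) (natCast_mul_omegaElt hθ hd hω h)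
  simp only [map_mul, norm_natCast_cubic h3, Int.natAbs_mul, Int.natAbs_pow, Int.natAbs_natCast] at e
  rw [e, natAbs_norm_lin_coords hirr hθ h3 X]

/-- **`x ≠ 0`** when `N(X) ≠ 0`. [folklore] -/
theorem omegaElt_ne_zero (hirr : Irreducible (MonicCubic.polyQ a b c))
    (hθ : aeval θ (MonicCubic.poly a b c) = 0) (h3 : finrank ℚ K = 3) {u : ℤ × ℤ × ℤ} {d : ℕ} (hd : 0 < d)
    {a' b' c' : ℤ} (hω : aeval (eta θ u d) (MonicCubic.poly a' b' c') = 0) {M : ℕ} {X W : ℤ × ℤ × ℤ}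
    (h : omegaCheck u d M X W = true) (hN : normFormZ a b c X.1 X.2.1 X.2.2 ≠ 0) : omegaElt hθ hω W ≠ 0 := by
  intro h0
  have e := natAbs_norm_omegaElt_mul hirr hθ h3 hd hω h
  rw [h0, Algebra.norm_zero, Int.natAbs_zero, mul_zero] at e
  exact hN (Int.natAbs_eq_zero.mp e.symm)

/-! ## Kernel sanity: the field `Δ_K = −26743` -/

/-- `g = X³ − X² − 20X − 124`, `ω = (−14 − 3α + α²)/4`, `h = X³ + X² + 42X − 144`. -/
example : etaCheck (-1) (-20) (-124) (-14, -3, 1) 4 1 42 (-144) = true := by decide +kernel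

/-- The dyadic separator `s = −ω`: `X = 4·s = (14, 3, −1)` (`M = d = 4`), `W = (0, 0, −1)`. -/
example : omegaCheck (-14, -3, 1) 4 4 (14, 3, -1) (0, 0, -1) = true := by decide +kernel

/-- … and it IS the avatar. -/
example : avatarD (-14, -3, 1) 4 (0, 0, -1) = (14, 3, -1) := by decide +kernel

/-- A curve-layer multiplier `M = 16` (`r₁ = 4`): `16·(1 + α − ω) = 4·(4·(1, 1, 0) − u) = (72, 28, −4)`. -/
example : omegaCheck (-14, -3, 1) 4 16 (72, 28, -4) (1, 1, -1) = true := by decide +kernel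

/-- NEG control: a wrong avatar is rejected. -/
example : omegaCheck (-14, -3, 1) 4 16 (72, 28, -3) (1, 1, -1) = false := by decide +kernel

end Summit.BirchSwinnertonDyer.BirchSwinnertonDyer.Rank2Observatory.TwoDescCl
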